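import Literature.NumberTheory.Rogawski1990.UnitOrbitalIntegralInertSumsThetaZero
import Mathlib.Algebra.BigOperators.Finprod
import HarnessLib

/-!
# Flicker's Propositions 14 and 11 in LAYER C: the `Σᶠ`-bridges from the counted orbital integrals (`θ̄ = 0`, `θ̄ = 1`) to `φ₀`, `φ₁` over VALUE binders
(Flicker (1998), Cor. 9 p. 85, Prop. 11 p. 87, Prop. 14 p. 94; values-abstract pattern of the line «N7nsCount», SPEC-F12 (S2)(iii))

Topic `NumberTheory/Rogawski1990`; namespace `Literature.NumberTheory.Rogawski1990.Flicker1998`.  THEOREMS ONLY (no `def`, no instance, no notation, no named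
fact, no `sorry`); pure arithmetic (no groups).  Cell `pub/hodgecm-mathlib`, road «D-N7-inert» ∕ MAP v3 «N7-ns COUNT FROM FLICKER», brick «FLICKER PROP. 14»
(LEAD F0P3a-plan (g9) T8-59 (B); pen F0P3b-p01 (g6) under A-p03 (g24) pen 1; census `F0/P3/F0P3b-p01/g6/CENSUS-F8-Prop14-ValuesThetaZero.F0P3bp01g6.md`).
HC_CM is proved only modulo the 2 remaining named inputs (hLiu418, h413) until rung 0 closes; this file is arithmetic and pays no letter by itself.

THE MATHEMATICS.  By Prop. 5 (★ `natCard_fixedPoints_unitaryInt_eq_finsum_flickerU`) and Cor. 9 counted (★ `natCard_fixedPoints_eq_finsum_relIndex_mul`) the unit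
orbital integral of the `θ̄ = 0` class is `Σᶠ_{m ≥ 0} Σᶠ_{j ≡ 0 (2)} w(j) · I(j, m)` with `w(j) = [T : T_j]` (= ★ `corNineWeight`: `1` at `j = 0`, `(1+q⁻¹)q^j` for
`j ≥ 1`) and `I(j, m)` the `P_H`-counts; Props. 10∕13 (LAYER B) evaluate `I(0, m)` = ★ `iThirteen q N N₊ M m`, `I(j, m)` = ★ `iTen q (N − j) N₊ m` (`1 ≤ j ≤ N`), and
`I(j, m) = 0` for `j > N` (the conjugate `r_j⁻¹ t_θ r_j` leaves `K_H`).  This file proves, for an ABSTRACT `I : ℕ → ℕ → ℚ` carrying exactly these three value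
binders, that the double `Σᶠ` IS ★ `sumThetaZero q N N₊ M` (`finsum_finsum_corNineWeight_mul_eq_sumThetaZero`) and hence, by ★ LAYER A
`sumThetaZero_eq_phiZero`, Flicker's closed form **`φ₀(N₁, N₂, N)` = ★ `phiZero q N₁ N₂ N`** (`finsum_finsum_corNineWeight_mul_eq_phiZero`) — the value slot `Φ(⟦t₁⟧)` (all-norm class) of
SPEC-F12 (S2)(iii); the `θ̄ = 1` twin (Prop. 11: `Σᶠ Σᶠ = sumThetaOne = φ₁(N₊, N)`, classes `t₂, t₃, t₄`) is §3.  Supports: the tables vanish beyond `m = ν` ∕ `m = M + N` (`iTen_eq_zero_of_lt`, `iThirteen_eq_zero_of_lt`), so every `Σᶠ` is an honest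
`Finset.sum`; the `j`-sum is re-indexed by `ν = N − j` (`Finset.sum_range_reflect`).  §4 records the `ℕ → ℚ` cast companions of the
weights and of the printed values (LAYER B and (F3c) deliver natural numbers; A-p03 (g24) 04:39:15Z (2)(3)).

## References
* [Flicker1998UnitaryFL] Y. Z. Flicker, *Elementary proof of the fundamental lemma for a unitary group*, Canad. J. Math. 50 (1998): Cor. 9 p. 85, Prop. 10 p. 85,
  Prop. 13 p. 91, Prop. 14 p. 94.
* [Rogawski1990] J. D. Rogawski, *Automorphic Representations of Unitary Groups in Three Variables* (1990), §4.9 Prop. 4.9.1 (b) p. 55.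
-/

set_option autoImplicit false

namespace Literature.NumberTheory.Rogawski1990.Flicker1998

open Finset

variable {q : ℕ}

/-! ## §1 Supports of the printed tables -/

/-- Prop. 10's table vanishes beyond `m = ν`. [cite: Flicker1998UnitaryFL, Prop. 10 p. 85] -/
theorem iTen_eq_zero_of_lt (q : ℕ) {ν Np m : ℕ} (h : ν < m) : iTen q ν Np m = 0 := by
  unfold iTen
  have h0 : m ≠ 0 := by omega
  have h1 : ¬ m ≤ min (ν / 2) (Np / 2) := by
    intro hle; have := le_trans hle (min_le_left _ _); omega
  have h2 : ¬ (ν = Np ∧ ν < 2 * m ∧ m ≤ ν) := by rintro ⟨-, -, hle⟩; omega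
  rw [if_neg h0, if_neg h1, if_neg h2]

/-- Prop. 13's table vanishes beyond `m = M + N`. [cite: Flicker1998UnitaryFL, Prop. 13 p. 91] -/
theorem iThirteen_eq_zero_of_lt (q : ℕ) {N Np M m : ℕ} (h : M + N < m) : iThirteen q N Np M m = 0 := by
  unfold iThirteen
  have h0 : m ≠ 0 := by omega
  have h1 : ¬ m ≤ min (N / 2) (Np / 2) := by
    intro hle; have := le_trans hle (min_le_left _ _); omega
  have h2 : ¬ (N ≤ Np ∧ N / 2 + 1 ≤ m ∧ m ≤ min N (M / 2)) := by
    rintro ⟨-, -, hle⟩; have := le_trans hle (min_le_left _ _); omega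
  have h3 : ¬ (N ≤ Np ∧ M / 2 + 1 ≤ m ∧ m ≤ N ∧ (M - N) % 2 = 0) := by rintro ⟨-, -, hle, -⟩; omega
  have h4 : ¬ (N ≤ Np ∧ N + 1 ≤ m ∧ m ≤ M / 2) := by rintro ⟨-, -, hle⟩; omega
  have h5 : ¬ (N ≤ Np ∧ max (N + 1) (M / 2 + 1) ≤ m ∧ m ≤ (M + N) / 2 ∧ (M - N) % 2 = 0) := by rintro ⟨-, -, hle, -⟩; omega
  rw [if_neg h0, if_neg h1, if_neg h2, if_neg h3, if_neg h4, if_neg h5]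

/-- `Σᶠ_{m ≥ 0}` of Prop. 10's table is the finite sum ★ `innerSumTen` («`0 ≤ m ≤ ν`»). [cite: Flicker1998UnitaryFL, Prop. 10 p. 85] -/
theorem finsum_iTen_eq_innerSumTen (q ν Np : ℕ) : ∑ᶠ m, iTen q ν Np m = innerSumTen q ν Np := by
  rw [innerSumTen, finsum_eq_sum_of_support_subset]
  intro m hm
  rw [Function.mem_support] at hm
  rw [coe_range, Set.mem_Iio]
  by_contra h
  exact hm (iTen_eq_zero_of_lt q (by omega))

/-- `Σᶠ_{m ≥ 0}` of Prop. 13's table is the finite sum ★ `innerSumThirteen` («`0 ≤ m ≤ M + N`»). [cite: Flicker1998UnitaryFL, Prop. 13 p. 91] -/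
theorem finsum_iThirteen_eq_innerSumThirteen (q N Np M : ℕ) : ∑ᶠ m, iThirteen q N Np M m = innerSumThirteen q N Np M := by
  rw [innerSumThirteen, finsum_eq_sum_of_support_subset]
  intro m hm
  rw [Function.mem_support] at hm
  rw [coe_range, Set.mem_Iio]
  by_contra h
  exact hm (iThirteen_eq_zero_of_lt q (by omega))

/-! ## §2 The double `Σᶠ` over the value binders -/

section Values

variable (q : ℕ) {N Np M : ℕ} (I : ℕ → ℕ → ℚ)
  (h0 : ∀ m, I 0 m = iThirteen q N Np M m) (hpos : ∀ j m, 1 ≤ j → j ≤ N → I j m = iTen q (N - j) Np m) (hbig : ∀ j m, N < j → I j m = 0)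

include h0 hpos hbig

/-- For each `m`, the `j`-sum is finite: `Σᶠ_{j even} w(j) I(j,m) = I(0,m) + Σ_{1 ≤ j ≤ N, j even} w(j) I(j,m)` (the summands vanish for `j > N`).
[cite: Flicker1998UnitaryFL, Cor. 9 p. 85] -/
theorem finsum_corNineWeight_mul_eq_sum (m : ℕ) :
    ∑ᶠ j, (if j % 2 = 0 then corNineWeight q j * I j m else 0) =
      iThirteen q N Np M m + ∑ i ∈ range N, (if (i + 1) % 2 = 0 then corNineWeight q (i + 1) * iTen q (N - (i + 1)) Np m else 0) := by
  rw [finsum_eq_sum_of_support_subset (s := range (N + 1))]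
  · have hF0 : (if 0 % 2 = 0 then corNineWeight q 0 * I 0 m else 0) = iThirteen q N Np M m := by
      rw [if_pos rfl, h0, corNineWeight, if_pos rfl, one_mul]
    rw [sum_range_succ', hF0, add_comm]
    refine congrArg (fun x => iThirteen q N Np M m + x) (sum_congr rfl fun i hi => ?_)
    rw [mem_range] at hi
    rw [hpos (i + 1) m (by omega) (by omega)]
  · intro j hj
    rw [Function.mem_support] at hj
    rw [coe_range, Set.mem_Iio]
    by_contra h
    exact hj (by rw [hbig j m (by omega)]; simp)

/-- **THE `Σᶠ`-BRIDGE TO COR. 9 (θ̄ = 0)**: over the value binders, `Σᶠ_m Σᶠ_{j even} w(j) I(j,m) = ` ★ `sumThetaZero q N N₊ M` (`= Σ_m I₁₃(m) + Σ_{j even ≥ 2} w(j) Σ_m I₁₀(N−j; m)`,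
the `j`-sum re-indexed by `ν = N − j`). [cite: Flicker1998UnitaryFL, Cor. 9 p. 85; Prop. 12 p. 90; Prop. 14 p. 94] -/
theorem finsum_finsum_corNineWeight_mul_eq_sumThetaZero :
    ∑ᶠ m, ∑ᶠ j, (if j % 2 = 0 then corNineWeight q j * I j m else 0) = sumThetaZero q N Np M := by
  have hinner : ∀ m, ∑ᶠ j, (if j % 2 = 0 then corNineWeight q j * I j m else 0) =
      iThirteen q N Np M m + ∑ i ∈ range N, (if (i + 1) % 2 = 0 then corNineWeight q (i + 1) * iTen q (N - (i + 1)) Np m else 0) :=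
    finsum_corNineWeight_mul_eq_sum q I h0 hpos hbig
  simp_rw [hinner]
  -- the outer sum is finite: every summand vanishes for `m > M + N`
  rw [finsum_eq_sum_of_support_subset (s := range (M + N + 1))]
  · rw [sum_add_distrib, sumThetaZero, innerSumThirteen, sum_comm]
    congr 1
    -- `Σ_{i < N} [ (i+1) even ] w(i+1) Σ_m I₁₀(N−(i+1); m)`, re-indexed by `ν = N − 1 − i`
    rw [sumThetaZeroJ, ← sum_range_reflect]
    refine sum_congr rfl fun i hi => ?_
    rw [mem_range] at hi
    have hj : N - 1 - i + 1 = N - i := by omega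
    have hν : N - (N - i) = i := by omega
    rw [hj, hν]
    split_ifs with he
    · rw [← mul_sum, innerSumTen]
      congr 1
      have hsub : range (i + 1) ⊆ range (M + N + 1) := range_mono (Nat.succ_le_succ (le_trans hi.le (Nat.le_add_left N M)))
      refine (sum_subset hsub fun m _ hm' => ?_).symm
      rw [mem_range, not_lt] at hm'
      exact iTen_eq_zero_of_lt q hm'
    · exact sum_const_zero
  · intro m hm
    rw [Function.mem_support] at hm
    rw [coe_range, Set.mem_Iio]
    by_contra h
    refine hm ?_
    rw [iThirteen_eq_zero_of_lt q (by omega), zero_add]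
    refine sum_eq_zero fun i hi => ?_
    rw [mem_range] at hi
    rw [iTen_eq_zero_of_lt q (by omega)]
    simp

/-- **FLICKER'S PROPOSITION 14 IN LAYER C (values-abstract): `Σᶠ_m Σᶠ_{j even} w(j) I(j,m) = φ₀(N₁, N₂, N)`** — for any rational-valued table `I` with the three value binders
(`I(0,·)` = Prop. 13, `I(j,·)` = Prop. 10 at `ν = N − j` for `1 ≤ j ≤ N`, `0` beyond), in either elliptic regime of ★ `sumThetaZero_eq_phiZero` («`N₁ = N₂ = N₊ < N`» or
«`N ≤ N₁`, `N ≤ N₊`», `M = max N₁ N₂`) and `q > 1`: the `θ̄ = 0` unit orbital integral in counted form equals ★ `phiZero q N₁ N₂ N` (the slot `Φ(⟦t₁⟧)`, the all-norm class, of SPEC-F12 (S2)(iii) as corrected by A-p03 04:07:45Z).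
[cite: Flicker1998UnitaryFL, Prop. 14 p. 94; Cor. 9 p. 85] -/
theorem finsum_finsum_corNineWeight_mul_eq_phiZero (hq : 1 < q) {N₁ N₂ : ℕ} (hM : M = max N₁ N₂)
    (h : (N₁ < N ∧ N₂ = N₁ ∧ Np = N₁) ∨ (N ≤ N₁ ∧ N ≤ Np)) :
    ∑ᶠ m, ∑ᶠ j, (if j % 2 = 0 then corNineWeight q j * I j m else 0) = phiZero q N₁ N₂ N := by
  rw [finsum_finsum_corNineWeight_mul_eq_sumThetaZero q I h0 hpos hbig, hM]
  exact sumThetaZero_eq_phiZero hq h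

/-- **The same for a natural-number-valued count `A(m) = #Fix_t(H ⧸ H^K_m)`** whose Cor. 9 expansion is given as a binder: `Σᶠ_m A(m) = φ₀(N₁, N₂, N)` in `ℚ` — the
consumer's shape after ★ `natCard_fixedPoints_unitaryInt_eq_finsum_flickerU` (Prop. 5) and ★ `natCard_fixedPoints_eq_finsum_relIndex_mul` (Cor. 9).
[cite: Flicker1998UnitaryFL, Prop. 5 p. 82; Cor. 9 p. 85; Prop. 14 p. 94] -/
theorem finsum_natCast_eq_phiZero (hq : 1 < q) {N₁ N₂ : ℕ} (hM : M = max N₁ N₂)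
    (h : (N₁ < N ∧ N₂ = N₁ ∧ Np = N₁) ∨ (N ≤ N₁ ∧ N ≤ Np)) (A : ℕ → ℕ)
    (hA : ∀ m, (A m : ℚ) = ∑ᶠ j, (if j % 2 = 0 then corNineWeight q j * I j m else 0)) :
    ∑ᶠ m, (A m : ℚ) = phiZero q N₁ N₂ N := by
  simp_rw [hA]
  exact finsum_finsum_corNineWeight_mul_eq_phiZero q I h0 hpos hbig hq hM h

end Values

/-! ## §3 The `θ̄ = 1` twin (Prop. 11): `Σᶠ_m Σᶠ_{j odd} w(j) I(j,m) = φ₁(N₊, N)` -/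

section ValuesOdd

variable (q : ℕ) {N Np : ℕ} (I : ℕ → ℕ → ℚ)
  (hpos : ∀ j m, 1 ≤ j → j ≤ N → I j m = iTen q (N - j) Np m) (hbig : ∀ j m, N < j → I j m = 0)

include hpos hbig

/-- For each `m`, the odd `j`-sum is finite: `Σᶠ_{j odd} w(j) I(j,m) = Σ_{1 ≤ j ≤ N, j odd} w(j) I₁₀(N−j; m)`. [cite: Flicker1998UnitaryFL, Cor. 9 p. 85] -/
theorem finsum_corNineWeight_mul_odd_eq_sum (m : ℕ) :
    ∑ᶠ j, (if j % 2 = 1 then corNineWeight q j * I j m else 0) =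
      ∑ i ∈ range N, (if (i + 1) % 2 = 1 then corNineWeight q (i + 1) * iTen q (N - (i + 1)) Np m else 0) := by
  rw [finsum_eq_sum_of_support_subset (s := range (N + 1))]
  · rw [sum_range_succ', Nat.zero_mod, if_neg Nat.zero_ne_one, add_zero]
    refine sum_congr rfl fun i hi => ?_
    rw [mem_range] at hi
    rw [hpos (i + 1) m (by omega) (by omega)]
  · intro j hj
    rw [Function.mem_support] at hj
    rw [coe_range, Set.mem_Iio]
    by_contra h
    exact hj (by rw [hbig j m (by omega)]; simp)

/-- **THE `Σᶠ`-BRIDGE TO COR. 9 (θ̄ = 1)**: `Σᶠ_m Σᶠ_{j odd} w(j) I(j,m) = ` ★ `sumThetaOne q N N₊`. [cite: Flicker1998UnitaryFL, Cor. 9 p. 85; Prop. 11 p. 87] -/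
theorem finsum_finsum_corNineWeight_mul_odd_eq_sumThetaOne :
    ∑ᶠ m, ∑ᶠ j, (if j % 2 = 1 then corNineWeight q j * I j m else 0) = sumThetaOne q N Np := by
  have hinner : ∀ m, ∑ᶠ j, (if j % 2 = 1 then corNineWeight q j * I j m else 0) =
      ∑ i ∈ range N, (if (i + 1) % 2 = 1 then corNineWeight q (i + 1) * iTen q (N - (i + 1)) Np m else 0) :=
    finsum_corNineWeight_mul_odd_eq_sum q I hpos hbig
  simp_rw [hinner]
  rw [finsum_eq_sum_of_support_subset (s := range (N + 1))]
  · rw [sumThetaOne, sum_comm, ← sum_range_reflect]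
    refine sum_congr rfl fun i hi => ?_
    rw [mem_range] at hi
    have hj : N - 1 - i + 1 = N - i := by omega
    have hν : N - (N - i) = i := by omega
    rw [hj, hν]
    split_ifs with he
    · rw [← mul_sum, innerSumTen]
      congr 1
      have hsub : range (i + 1) ⊆ range (N + 1) := range_mono (Nat.succ_le_succ hi.le)
      refine (sum_subset hsub fun m _ hm' => ?_).symm
      rw [mem_range, not_lt] at hm'
      exact iTen_eq_zero_of_lt q hm'
    · exact sum_const_zero
  · intro m hm
    rw [Function.mem_support] at hm
    rw [coe_range, Set.mem_Iio]
    by_contra h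
    refine hm (sum_eq_zero fun i hi => ?_)
    rw [mem_range] at hi
    rw [iTen_eq_zero_of_lt q (by omega)]
    simp

/-- **FLICKER'S PROPOSITION 11 IN LAYER C (values-abstract): `Σᶠ_m Σᶠ_{j odd} w(j) I(j,m) = φ₁(N₊, N)`** (classes `t₂, t₃, t₄` of SPEC-F12 (S2)(iii); ★
`sumThetaOne_eq_phiOne`, no regime hypothesis). [cite: Flicker1998UnitaryFL, Prop. 11 p. 87; Cor. 9 p. 85] -/
theorem finsum_finsum_corNineWeight_mul_odd_eq_phiOne (hq : 1 < q) :
    ∑ᶠ m, ∑ᶠ j, (if j % 2 = 1 then corNineWeight q j * I j m else 0) = phiOne q Np N := by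
  rw [finsum_finsum_corNineWeight_mul_odd_eq_sumThetaOne q I hpos hbig]
  exact sumThetaOne_eq_phiOne hq N Np

/-- The ℕ-valued form: `Σᶠ_m A(m) = φ₁(N₊, N)` for counts `A(m)` with the odd Cor. 9 expansion as a binder. [cite: Flicker1998UnitaryFL, Prop. 11 p. 87] -/
theorem finsum_natCast_eq_phiOne (hq : 1 < q) (A : ℕ → ℕ)
    (hA : ∀ m, (A m : ℚ) = ∑ᶠ j, (if j % 2 = 1 then corNineWeight q j * I j m else 0)) :
    ∑ᶠ m, (A m : ℚ) = phiOne q Np N := by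
  simp_rw [hA]
  exact finsum_finsum_corNineWeight_mul_odd_eq_phiOne q I hpos hbig hq

end ValuesOdd

/-! ## §4 Cast companions: the ℕ-valued weights and counts of (F3c) ∕ LAYER B as the printed rationals -/

/-- The weight `[T : T_j] = 1, (q+1)q^{j−1}` as ★ `corNineWeight` (`(1 + q⁻¹) q^j = (q+1) q^{j−1}`). [cite: Flicker1998UnitaryFL, Prop. 7 p. 84; Cor. 9 p. 85] -/
theorem natCast_weight_eq_corNineWeight (hq : 1 ≤ q) (j : ℕ) :
    (((if j = 0 then 1 else (q + 1) * q ^ (j - 1) : ℕ)) : ℚ) = corNineWeight q j := by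
  unfold corNineWeight
  split_ifs with hj
  · simp
  · obtain ⟨k, rfl⟩ := Nat.exists_eq_succ_of_ne_zero hj
    have hq0 : (q : ℚ) ≠ 0 := by exact_mod_cast (by omega : q ≠ 0)
    rw [Nat.succ_sub_one, pow_succ]
    push_cast
    field_simp

/-- Prop. 10∕13 case (a): `(q² − 1) q^{4m−2} = (1 − q⁻²) q^{4m}` (`m ≥ 1`). [cite: Flicker1998UnitaryFL, Prop. 10 p. 85; Prop. 13 p. 91] -/
theorem natCast_count_a_eq (hq : 1 ≤ q) {m : ℕ} (hm : 1 ≤ m) :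
    (((q ^ 2 - 1) * q ^ (4 * m - 2) : ℕ) : ℚ) = (1 - ((q : ℚ) ^ 2)⁻¹) * (q : ℚ) ^ (4 * m) := by
  have hq0 : (q : ℚ) ≠ 0 := by exact_mod_cast (by omega : q ≠ 0)
  have h4 : 4 * m = 4 * m - 2 + 2 := by omega
  have hsq : 1 ≤ q ^ 2 := Nat.one_le_pow _ _ (by omega)
  rw [h4, pow_add, Nat.add_sub_cancel]
  push_cast [Nat.cast_sub hsq]
  field_simp

/-- Prop. 10 case 3 ∕ Prop. 13 (b)(d): `(q + 1) q^{k−1} = (1 + q⁻¹) q^{k}` (`k ≥ 1`). [cite: Flicker1998UnitaryFL, Prop. 10 p. 85; Prop. 13 p. 91] -/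
theorem natCast_count_b_eq (hq : 1 ≤ q) {k : ℕ} (hk : 1 ≤ k) :
    (((q + 1) * q ^ (k - 1) : ℕ) : ℚ) = (1 + ((q : ℚ))⁻¹) * (q : ℚ) ^ k := by
  have hq0 : (q : ℚ) ≠ 0 := by exact_mod_cast (by omega : q ≠ 0)
  obtain ⟨j, rfl⟩ := Nat.exists_eq_add_of_le hk
  rw [Nat.add_sub_cancel_left, pow_add, pow_one]
  push_cast
  field_simp

/-- Prop. 13 (c)(e): `(q + 1)² q^{k−2} = (1 + q⁻¹)² q^{k}` (`k ≥ 2`). [cite: Flicker1998UnitaryFL, Prop. 13 p. 91] -/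
theorem natCast_count_c_eq (hq : 1 ≤ q) {k : ℕ} (hk : 2 ≤ k) :
    (((q + 1) ^ 2 * q ^ (k - 2) : ℕ) : ℚ) = (1 + ((q : ℚ))⁻¹) ^ 2 * (q : ℚ) ^ k := by
  have hq0 : (q : ℚ) ≠ 0 := by exact_mod_cast (by omega : q ≠ 0)
  obtain ⟨j, rfl⟩ := Nat.exists_eq_add_of_le hk
  rw [Nat.add_sub_cancel_left, pow_add]
  push_cast
  field_simp

end Literature.NumberTheory.Rogawski1990.Flicker1998
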